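import Summits.QuantumAdvantage.QuantumAdvantage.Theses.OddPrimeWalk
import Summits.QuantumAdvantage.QuantumAdvantage.Theorems.WalkThreeStepRigidLossFar
import Summits.QuantumAdvantage.QuantumAdvantage.Theorems.WalkThreeStepFreeSymmetry
import Summits.QuantumAdvantage.QuantumAdvantage.Theorems.WalkThreeStepUsableBound
import Summits.QuantumAdvantage.QuantumAdvantage.Theorems.WalkIntervalFibre

/-!
# Rung (G♯₂) `ThreeStepFreeRungFive` (item stmt-QuantumAdvantage-23286): the ASSEMBLY of architecture (U) modulo the FAR-READ LEMMA

Cell qa-qnc0, route OddPrimeWalk, support item stmt-QuantumAdvantage-23286 (planner qa-qnc0-p2 g27, ROUND-27 §4 U-f); prover qn-prover-3 g16.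

**`threeStepFreeRungFive_of_farRead : FarReadHyp → OddPrimeWalk.ThreeStepFreeRungFive`** — the item follows from ONE remaining statement,
the far-read lemma in the form the engine consumes:
  `FarReadHyp := ∃ R W, ∀ n c S a L, W + 1 ≤ a → a + L + W ≤ n → (every position k of the W-neighbourhood (a − W, a + L + W) is
  Degenerate for (S, c) AND the register is invariant under the transposition at k) → ∃ S' with S'.y = S.y and NearReads S' R a L`
(re-representation allowed: constant cuts may be re-encoded with zero coefficients; `R`, `W` absolute).
Assembly (θ = max(1 − η(M), 3/4)): `R, W` from the hypothesis; `L := L₀(R, 1/12)` from `rigid_loss_far`; `L' = L + 2W + 2`, hub threshold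
`M = 8L' + 8`, `η, m₀` from `usableBound M`, zone room `Z = 9(2M + 4)`.  Given `n ≥ n₀`, `c`, a three-step `y = S.y`: either some position
`k ∈ [m₀, n − m₀]` with `coSplit ≤ M` is usable — then `usableBound` —, or all such positions are degenerate; the bad positions (hubs, by
`hubCount` at most `2(n+1)/M`; the ≤ 3(Z+1) positions observed by the cuts positioned in the last `Z`; and `[0, m₀]`) miss some block of
length `L'` below `n − Z − m₀` (`exists_clean_interval`); on its middle part `[a, a+L)` every position of the W-neighbourhood is degenerate with
observers below `n − Z`, so `reg_cornerFlip_free` gives the register symmetry, the hypothesis gives `NearReads` for an equivalent `S'`,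
`rigid_loss_far` bounds every fibre by `(3/4)·2^L` and `card_le_of_fibre_le` sums the fibres.
WHAT THIS IS NOT: the item is NOT closed — `FarReadHyp` (module U-c1) is open; separation NOT moved.
-/

namespace Summit.QuantumAdvantage.AdviceFreeQNC0.LocalEngine

open Finset Classical

namespace RungU

variable {p n : ℕ}

/-- registers only see the selection functions. -/
theorem reg_congr_y {S S' : ThreeStep p n} (h : S'.y = S.y) (x : Fin n → Bool) : reg S' x = reg S x := by
  unfold reg term
  simp only [h]

/-- **THE FAR-READ HYPOTHESIS** (module U-c1 in the form the assembly consumes). -/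
def FarReadHyp : Prop :=
  ∃ R W : ℕ, ∀ (n c : ℕ) (S : ThreeStep 5 n) (a L : ℕ), W + 1 ≤ a → a + L + W ≤ n →
    (∀ k : ℕ, a ≤ k + W → k < a + L + W →
      Degenerate c S k ∧ ∀ x : Fin n → Bool, reg S (cornerFlip n k x) = reg S x) →
    ∃ S' : ThreeStep 5 n, S'.y = S.y ∧ NearReads S' R a L

/-- **ASSEMBLY OF ARCHITECTURE (U) MODULO THE FAR-READ LEMMA.** -/
theorem threeStepFreeRungFive_of_farRead (hFR : FarReadHyp) :
    Summit.QuantumAdvantage.QuantumAdvantage.Theses.OddPrimeWalk.ThreeStepFreeRungFive := by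
  unfold Summit.QuantumAdvantage.QuantumAdvantage.Theses.OddPrimeWalk.ThreeStepFreeRungFive
  obtain ⟨R, W, hfar⟩ := hFR
  obtain ⟨L, hL⟩ := rigid_loss_far (p := 5) (by norm_num) (by norm_num) R (ε := 1 / 12) (by norm_num)
  have hU0 := usableBound
  unfold UsableBound at hU0
  obtain ⟨η, hη, m₀, hU⟩ := hU0 (8 * (L + 2 * W + 2) + 8)
  have hH0 := hubCount
  unfold HubCount at hH0
  -- names for the constants (opaque, with defining equations)
  obtain ⟨L', hL'⟩ : ∃ L' : ℕ, L' = L + 2 * W + 2 := ⟨_, rfl⟩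
  obtain ⟨M, hM⟩ : ∃ M : ℕ, M = 8 * L' + 8 := ⟨_, rfl⟩
  rw [← hL', ← hM] at hU
  obtain ⟨Z, hZ⟩ : ∃ Z : ℕ, Z = (2 * M + 4) * 9 := ⟨_, rfl⟩
  refine ⟨max (1 - η) (3 / 4), max_lt (by linarith) (by norm_num), 8 * ((3 * Z + m₀ + 8) * L' + Z + m₀ + 1), ?_⟩
  intro n hn c y hy
  obtain ⟨S, rfl⟩ := exists_threeStep_of_sel y hy
  have h2n : (0 : ℝ) ≤ (2 : ℝ) ^ n := by positivity
  by_cases hcase : ∃ k, m₀ ≤ k ∧ k + m₀ ≤ n ∧ coSplit S k ≤ M ∧ ¬ Degenerate c S k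
  · -- a usable non-hub position
    obtain ⟨k, hk1, hk2, hk3, hk4⟩ := hcase
    have h := hU n c S k hk1 hk2 hk3 hk4
    unfold winCount at h
    exact h.trans (mul_le_mul_of_nonneg_right (le_max_left _ _) h2n)
  · -- every non-hub position in range is degenerate
    push Not at hcase
    have hL'1 : 1 ≤ L' := by omega
    have hZn : Z + m₀ + L' ≤ n := by
      have : L' ≤ (3 * Z + m₀ + 8) * L' := Nat.le_mul_of_pos_left L' (by omega)
      omega
    -- the bad positions
    set hubs : Finset ℕ := (range (n + 1)).filter fun k => M < coSplit S k with hhubs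
    set endObs : Finset ℕ := ((univ : Finset (Fin (n + 1))).filter fun g => n ≤ g.val + Z).biUnion
      fun g => ({g.val, S.s g, S.t g} : Finset ℕ) with hendObs
    set B : Finset ℕ := hubs ∪ endObs ∪ range (m₀ + 1) with hB
    have hhc : M * hubs.card ≤ 2 * (n + 1) := hH0 n M S (by omega)
    have hends : ((univ : Finset (Fin (n + 1))).filter fun g => n ≤ g.val + Z).card ≤ Z + 1 := by
      have himg : (((univ : Finset (Fin (n + 1))).filter fun g => n ≤ g.val + Z).image Fin.val) ⊆ Finset.Icc (n - Z) n := by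
        intro v hv
        rw [Finset.mem_image] at hv
        obtain ⟨g, hg, rfl⟩ := hv
        rw [Finset.mem_filter] at hg
        rw [Finset.mem_Icc]
        have := g.isLt
        omega
      have h1 := Finset.card_le_card himg
      rw [Finset.card_image_of_injective _ Fin.val_injective, Nat.card_Icc] at h1
      omega
    have hendc : endObs.card ≤ (Z + 1) * 3 := by
      have h := Finset.card_biUnion_le_card_mul ((univ : Finset (Fin (n + 1))).filter fun g => n ≤ g.val + Z)
        (fun g => ({g.val, S.s g, S.t g} : Finset ℕ)) 3 (fun g _ => Finset.card_le_three)
      exact h.trans (Nat.mul_le_mul_right 3 hends)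
    have hBc : B.card ≤ hubs.card + (Z + 1) * 3 + (m₀ + 1) := by
      have h1 : B.card ≤ (hubs ∪ endObs).card + (range (m₀ + 1)).card := Finset.card_union_le _ _
      have h2 : (hubs ∪ endObs).card ≤ hubs.card + endObs.card := Finset.card_union_le _ _
      rw [Finset.card_range] at h1
      omega
    -- a clean block of length L' below n - Z - m₀
    have hkey : 4 * (L' * hubs.card) ≤ n + 1 := by
      have e : M * hubs.card = 8 * (L' * hubs.card) + 8 * hubs.card := by rw [hM]; ring
      omega
    have hNL : (B.card + 1) * L' ≤ n - Z - m₀ := by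
      have h1 : (B.card + 1) * L' ≤ (hubs.card + ((Z + 1) * 3 + (m₀ + 1) + 1)) * L' := Nat.mul_le_mul_right L' (by omega)
      have h2 : (hubs.card + ((Z + 1) * 3 + (m₀ + 1) + 1)) * L' = L' * hubs.card + ((Z + 1) * 3 + (m₀ + 1) + 1) * L' := by ring
      have h3 : ((Z + 1) * 3 + (m₀ + 1) + 1) * L' ≤ (3 * Z + m₀ + 8) * L' := Nat.mul_le_mul_right L' (by omega)
      have h4 : 8 * ((3 * Z + m₀ + 8) * L' + Z + m₀ + 1) ≤ n := hn
      have h5 : L' * hubs.card + (3 * Z + m₀ + 8) * L' + Z + m₀ ≤ n := by omega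
      rw [h2] at h1
      omega
    obtain ⟨j, hj1, hj2⟩ := exists_clean_interval B L' (n - Z - m₀) hNL
    set a := j * L' + W + 1 with ha
    -- every position of the neighbourhood is good
    have good : ∀ k, a ≤ k + W → k < a + L + W →
        m₀ + 1 ≤ k ∧ k + Z + m₀ < n ∧ coSplit S k ≤ M ∧ ∀ g : Fin (n + 1), Observes S g k → g.val + Z < n := by
      intro k h1 h2
      have hkB : k ∉ B := fun hk => hj2 k hk ⟨by omega, by omega⟩
      rw [hB, Finset.mem_union, Finset.mem_union, not_or, not_or, Finset.mem_range] at hkB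
      obtain ⟨⟨hk1, hk2⟩, hk3⟩ := hkB
      refine ⟨by omega, by omega, ?_, ?_⟩
      · by_contra hc
        apply hk1
        rw [hhubs, Finset.mem_filter, Finset.mem_range]
        exact ⟨by omega, by omega⟩
      · intro g hg
        by_contra hc
        apply hk2
        rw [hendObs, Finset.mem_biUnion]
        refine ⟨g, ?_, ?_⟩
        · rw [Finset.mem_filter]; exact ⟨mem_univ _, by omega⟩
        · unfold Observes at hg
          simp only [Finset.mem_insert, Finset.mem_singleton]
          omega
    have hdegsym : ∀ k : ℕ, a ≤ k + W → k < a + L + W →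
        Degenerate c S k ∧ ∀ x : Fin n → Bool, reg S (cornerFlip n k x) = reg S x := by
      intro k h1 h2
      obtain ⟨g1, g2, g3, g4⟩ := good k h1 h2
      have hd : Degenerate c S k := hcase k (by omega) (by omega) g3
      refine ⟨hd, fun x => ?_⟩
      exact reg_cornerFlip_free (p := 5) (by norm_num) (by norm_num) c S (k := k) (z₀ := n - Z) (by omega) (by omega) hd
        (fun g hg => by have := g4 g hg; omega)
        (by have h9 : (2 * coSplit S k + 4) * (2 * 5 - 1) ≤ Z := by
              rw [hZ]; exact Nat.mul_le_mul (by omega) (by norm_num)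
            omega) x
    obtain ⟨S', hS'y, hnear⟩ := hfar n c S a L (by omega) (by omega) hdegsym
    have hsym' : RegSym S' a L := fun k hk1 hk2 x => by
      rw [reg_congr_y hS'y, reg_congr_y hS'y]; exact (hdegsym k (by omega) (by omega)).2 x
    have hfib := hL L le_rfl n c S' a hsym' hnear (by omega)
    rw [hS'y] at hfib
    have htot := card_le_of_fibre_le a L (by omega) (fun u => ringWinU c S.y u) (2 / 3 + 1 / 12) (fun o _ => hfib o)
    calc ((((univ : Finset (Fin n → Bool)).filter fun u => ringWinU c S.y u = true).card : ℕ) : ℝ)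
        ≤ (2 / 3 + 1 / 12) * (2 : ℝ) ^ n := htot
      _ ≤ max (1 - η) (3 / 4) * (2 : ℝ) ^ n := by
          apply mul_le_mul_of_nonneg_right _ h2n
          exact le_trans (by norm_num) (le_max_right _ _)

end RungU

end Summit.QuantumAdvantage.AdviceFreeQNC0.LocalEngine
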